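import Summits.QuantumFields.YangMills.Theorems.BalabanUVNodesN15KingModelTwoSpacingOneDatum
import Literature.MathematicalPhysics.QuantumFieldTheory.Balaban1983to89.B5Bound128Uniform
import Mathlib.Data.Fin.Tuple.Sort
import HarnessLib

/-!
# BalabanUVNodes ∕ N15 — THE KING-MODEL RUNG, CURVED EDITION (PART Μ): THE POWER-COUNTING LETTERS OF KING 1986 §3.4 — (3.58)–(3.59)
# (multiplying out the slice sums over the internal lines, orderings), **(3.67)** (transfer of exponential decay), **(3.68)** (the lattice sum on `T_η`),
# **(3.69)–(3.70)** (the slice sums and the extraction of `L^{−γk}`) — PROVED, the torus letters on the rung's carriers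
# (Track A, DAG node N15 = NE2; FAN-OUT v1.1 §N15 s3 «KING-MODEL RUNG»)

HONEST FRAMING.  Count-neutral (cell `pub-ymgap`, seat `pub-ymgap-dag-n15-e` g24; `--supports stmt-QuantumFields-27366 --as helper` = K3⁸
`SpineGivenEndpointR13SepCoPHV`).  TEMPLATE LITERATURE: C. King, *The U(1) Higgs model. I. The continuum limit*, Commun. Math. Phys. **102** (1986) 649–677
[King1986], proof of Proposition 3.6, pp. 663–664: the ELEMENTARY ANALYTIC LETTERS of the power counting, proved generically and on the rung's tori.  The GRAPH
MACHINERY they serve — the graphs `H̃`, the degrees `D(H_i)` of the subgraphs (3.66), the renormalised graphs of §3.5, the bound (3.56) itself — is NOT typed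
here (XL; said).  NOT Bałaban's non-abelian objects; NOT a node discharge; nothing continuum ∕ ℝ⁴ ∕ OS ∕ mass-gap ∕ Clay.  0 `sorry`; standard axioms.  Page renders
READ AS IMAGES: `run/shared/lean/pub/pub-balaban/b2b-balaban-t4-ne2-p3/king-renders/1986-cmp102-king-u1-higgs-I-p015-x2.png` (p. 663),
`…/b2b-balaban-template/king-renders/…-p016-x2.png` (p. 664).

THE PRINT (verbatim).  p. 663: *«Every internal line in H̃ carries a propagator G_k, G_k(0) or one of their derivatives, which may be decomposed by writing
G^η_k = Σ_{j=0}^{k−1} G^η_{(j)}, see (2.17). The resulting product of sums is multiplied out and rewritten as a sum over orderings l̃ = {l(1), …, l(m)} of the m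
internal lines. This is followed by a sum over integers {j_{l(p)}}, p = 1, …, m, compatible with this ordering, meaning j_{l(1)} ≤ j_{l(2)} ≤ … ≤ j_{l(m)}. (3.58)
A term with two or more integers equal is arbitrarily assigned to one of the orderings with which it is compatible. … E^{(k)}(H̃) = Σ_{l̃} Σ_{j compatible with l̃}
E^{(k)}(H̃(j)). (3.59) … for convenience we write the decomposition of G^{η′}_{k+n} in the form G^{η′}_{k+n} = Σ_{j=−n}^{k−1} G^{η′}_{(j)}»*; p. 664: *«These
propagators are "transferred" to x by using the inequality exp[−δ₀L^{k−j_{l(p)}}|y − z| − δ₁L^{k−j_{l(1)}}|x − y|] ≤ exp[−δ₁L^{k−j_{l(p)}}|x − z|], (3.67) where δ₁ is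
a fraction of δ₀ … We then sum over y, giving Σ_y η^dχ(y) exp[−δ₁L^{k−j_{l(1)}}|x − y|] ≤ C[L^{k−j_{l(1)}}]^{−d}. (3.68) … If l(2) ∈ S^c, we can sum over
j_{l(1)} ≤ j_{l(2)}, since D(H₁) > 0: Σ_{j=−n}^{j_{l(2)}} (L^{j−k})^{D(H₁)} ≤ C(L^{j_{l(2)}−k})^{D(H₁)}. (3.69) … This gives Σ_{j=−n}^{0} (L^{j−k})^{D(H_i)} ≤
C(L^{−k})^{D(H_i)} ≤ CL^{−γk}(L^{j_{l(i+1)}−k})^{D(H_i)−γ}. (3.70)  For γ small enough, D(H_i) − γ > 0 and we continue the process»*.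

WHAT THIS FILE PROVES (namespace `…N15KingModelRung.Curved`; the fine run's slice index is written `i = j + n ∈ {0, …, k+n−1}` — King's «−n ≤ j ≤ k − 1» —
so that King's weight `(L^{j−k})^D` is `x^{(k+n)−i}` with `x = L^{−D}`, natural powers only).
* §1 (3.58)–(3.59): ★ `prod_sliceSum_eq_sum_assignments` — the product over the internal lines of the slice sums is the sum over ALL assignments
  `j : lines → slices` of the products (`Finset.prod_univ_sum`), and `exists_compatible_ordering` — every assignment `j` on `m` lines is compatible (3.58)
  with SOME ordering `l̃` (`Monotone (j ∘ σ)`; Mathlib's `Tuple.sort`; King's «arbitrarily assigned to one of the orderings with which it is compatible»).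
* §2 (3.67): ★ `exp_transfer_le` — for distances with the triangle inequality, scale factors `a_p ≤ a_1` (King's `L^{k−j_{l(p)}} ≤ L^{k−j_{l(1)}}`, `j_{l(p)} ≥
  j_{l(1)}`) and `0 ≤ δ₁ ≤ δ₀`: `exp[−δ₀a_p|y − z| − δ₁a_1|x − y|] ≤ exp[−δ₁a_p|x − z|]`; on the rung's tori `exp_transfer_tdistT_le` (King's letters verbatim:
  `a = L^{k−j}`, `|·|` = `tdistT`).
* §3 (3.68): ★★ `sum_eta_pow_mul_exp_le` — on `T_η = Tor (fine (L^k) M)` (`η = L^{−k}`, `|x − y|` in UNIT-lattice units = `tdistT∕L^k`, so King's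
  `δ₁L^{k−j}|x − y|` = `δ₁·tdistT∕L^j` and `[L^{k−j}]^{−1} = L^j∕L^k`, `slice_div_eq_inv_pow`), for `χ ≤ 1`, `δ₁ > 0` and a slice `j`:
  `Σ_y η^{d+1}χ(y)exp[−δ₁·tdistT(x, y)∕L^j] ≤ C_{d+1}(δ₁)·(L^j∕L^k)^{d+1}` with `C_D(δ) = (2(1 + D∕δ))^D` (the tree's uniform torus sum
  `King1986.Torus.tdistT_sumBound` + `B5Bound128Uniform.latticeConst_div_le`), uniformly in `k`, the volume `M` and `x`.
* §4 (3.69)–(3.70): `geom_sum_le_inv_one_sub` (`Σ_{m<N} x^m ≤ (1 − x)^{−1}`, `0 ≤ x < 1`), ★ `sliceWeight_sum_le` ((3.69): `Σ_{i ≤ i₂} x^{K′−i} ≤ (1 − x)^{−1}x^{K′−i₂}`,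
  `K′ = k + n`, `i₂ ≤ K′`), ★ `sliceWeight_sum_fine_le` ((3.70), first inequality: the fine slices `i ≤ n`, i.e. `j ≤ 0`, sum to `≤ (1 − x)^{−1}x^k = C(L^{−k})^D`),
  ★ `rpow_extract_gamma` ((3.70), second inequality: `(L^{−k})^D ≤ L^{−γk}·(L^{j−k})^{D−γ}` for `j ≥ 0`, `γ ≤ D`, `L ≥ 1`), `sliceBase_lt_one`, and the dictionary
  `sliceWeight_eq_rpow` (`x^{K′−i} = (L^{j−k})^D` at `x = L^{−D}`, `i = j + n`).

HONEST SCOPE.  Letters only: (i) the internal lines are an abstract finite type, the slice kernels abstract reals (no graph, no vertex function); (ii) (3.68) is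
the torus sum with `χ ≤ 1` (King's `χ` is the partition-of-unity function; only `χ ≤ 1` is used), `|x − y|` = the rung's block∕site distance `tdistT` in
`η`-units; (iii) the degrees `D(H_i) > 0` are free parameters `D`; the statement «for γ small enough D(H_i) − γ > 0» is the hypothesis `γ ≤ D`.  N15 NOT
discharged; counts unmoved.
Locators: [King1986] (2.17) p.653, (3.58)–(3.61), (3.66) p.663, (3.67)–(3.70) p.664.
-/

noncomputable section

namespace Summit.QuantumFields.YangMills.BalabanUVNodes.N15KingModelRung.Curved

open scoped BigOperators
open Literature.MathematicalPhysics.QuantumFieldTheory.Balaban1983to89.B5Prop11Plancherel (Tor fine)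
open Literature.MathematicalPhysics.QuantumFieldTheory.Balaban1983to89.B4Sect5Proof (latticeConst)
open Literature.MathematicalPhysics.QuantumFieldTheory.Balaban1983to89.B5Bound128Uniform (latticeConst_div_le)
open Literature.MathematicalPhysics.QuantumFieldTheory.King1986.Torus (tdistT tdistT_sumBound tdistT_triangle tdistT_nonneg)

/-! ## §1 (3.58)–(3.59): multiplying out the slice sums over the internal lines; orderings -/

section Orderings

/-- ★ **(3.59), the multiplying-out**: for internal lines `Λ` carrying the slice decompositions `G_l = Σ_{j<k} G_{(j),l}` (2.17), the product of the sums is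
the sum over ALL slice assignments `j : Λ → {0, …, k−1}` of the products `Π_l G_{(j_l),l}` — the terms `E(H̃(j))`. [cite: King1986, (3.59) p.663, (2.17) p.653] -/
theorem prod_sliceSum_eq_sum_assignments {Λ : Type*} [Fintype Λ] [DecidableEq Λ] (k : ℕ) (G : Λ → ℕ → ℝ) :
    ∏ l, ∑ j ∈ Finset.range k, G l j = ∑ J ∈ Fintype.piFinset (fun _ : Λ => Finset.range k), ∏ l, G l (J l) :=
  Finset.prod_univ_sum (fun _ : Λ => Finset.range k) G

/-- ★ **(3.58), compatibility**: an assignment `j` of slice integers to the `m` internal lines is COMPATIBLE with the ordering `l̃ = σ` when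
`j_{l(1)} ≤ j_{l(2)} ≤ … ≤ j_{l(m)}`, i.e. `Monotone (j ∘ σ)`; every assignment is compatible with SOME ordering (sorting; King: *«A term with two or more
integers equal is arbitrarily assigned to one of the orderings with which it is compatible»*) — so the sum over assignments (3.59) can be rewritten as a sum
over orderings and compatible integers. [cite: King1986, (3.58)–(3.59) p.663] -/
theorem exists_compatible_ordering {m : ℕ} (j : Fin m → ℤ) : ∃ σ : Equiv.Perm (Fin m), Monotone (j ∘ σ) :=
  ⟨Tuple.sort j, Tuple.monotone_sort j⟩

end Orderings

/-! ## §2 (3.67): the transfer of exponential decay along the first line -/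

section Transfer

/-- ★ **(3.67)** generically: for a distance with the triangle inequality `|x − z| ≤ |x − y| + |y − z|`, scale factors `0 ≤ a_p ≤ a_1` (King's
`L^{k−j_{l(p)}} ≤ L^{k−j_{l(1)}}`, as `j_{l(p)} ≥ j_{l(1)}`) and `0 ≤ δ₁ ≤ δ₀`:
`exp[−δ₀a_p|y − z| − δ₁a_1|x − y|] ≤ exp[−δ₁a_p|x − z|]`. [cite: King1986, (3.67) p.664] -/
theorem exp_transfer_le {dxy dyz dxz a₁ aₚ δ₀ δ₁ : ℝ} (htri : dxz ≤ dxy + dyz) (hxy : 0 ≤ dxy) (hyz : 0 ≤ dyz)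
    (ha : aₚ ≤ a₁) (hap : 0 ≤ aₚ) (hδ : δ₁ ≤ δ₀) (hδ₁ : 0 ≤ δ₁) :
    Real.exp (-(δ₀ * aₚ * dyz) - δ₁ * a₁ * dxy) ≤ Real.exp (-(δ₁ * aₚ * dxz)) := by
  apply Real.exp_le_exp.2
  have h1 : δ₁ * aₚ * dxz ≤ δ₁ * aₚ * dxy + δ₁ * aₚ * dyz := by nlinarith [mul_nonneg hδ₁ hap]
  have h2 : δ₁ * aₚ * dxy ≤ δ₁ * a₁ * dxy := by nlinarith [mul_nonneg hδ₁ hxy]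
  have h3 : δ₁ * aₚ * dyz ≤ δ₀ * aₚ * dyz := by nlinarith [mul_nonneg hap hyz]
  linarith

variable {d : ℕ} (L : ℕ)

/-- **(3.67) ON THE RUNG's TORUS `T_η = Tor (fine (L^k) M)`** (`|x − y|` = `tdistT`, any units; scale factors `L^{e_p} ≤ L^{e_1}` for `e_p ≤ e_1`, i.e.
`e = k − j` with `j_{l(p)} ≥ j_{l(1)}`): `exp[−δ₀L^{e_p}|y − z| − δ₁L^{e_1}|x − y|] ≤ exp[−δ₁L^{e_p}|x − z|]`. [cite: King1986, (3.67) p.664] -/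
theorem exp_transfer_tdistT_le {N : ℕ} [NeZero N] (M : Fin (d + 1) → ℕ) [∀ μ, NeZero (M μ)] (hL : 1 ≤ L) {e₁ eₚ : ℕ} (he : eₚ ≤ e₁)
    {δ₀ δ₁ : ℝ} (hδ : δ₁ ≤ δ₀) (hδ₁ : 0 ≤ δ₁) (x y z : Tor (fine N M)) :
    Real.exp (-(δ₀ * (L : ℝ) ^ eₚ * tdistT (fine N M) y z) - δ₁ * (L : ℝ) ^ e₁ * tdistT (fine N M) x y)
      ≤ Real.exp (-(δ₁ * (L : ℝ) ^ eₚ * tdistT (fine N M) x z)) := by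
  have hLr : (1 : ℝ) ≤ L := by exact_mod_cast hL
  exact exp_transfer_le (tdistT_triangle (fine N M) x y z) (tdistT_nonneg (fine N M) x y) (tdistT_nonneg (fine N M) y z)
    (pow_le_pow_right₀ hLr he) (by positivity) hδ hδ₁

end Transfer

/-! ## §3 (3.68): the lattice sum on `T_η` -/

section LatticeSum

variable {d : ℕ} (L : ℕ) [NeZero L]

/-- ★★ **(3.68) ON `T_η = Tor (fine (L^k) M)`**: with `η = L^{−k}` and `|x − y| = tdistT(x, y)∕L^k` (UNIT-lattice units, as in King's
`T_η ⊃ T^{(k)}`), King's exponent `δ₁L^{k−j}|x − y|` is `δ₁·tdistT(x, y)∕L^j` and his right side `C[L^{k−j}]^{−d}` is `C·(L^jη)^d = C·(L^j∕L^k)^d`; for a weight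
`χ ≤ 1`, `δ₁ > 0` and ANY slice `j` (for `j ≥ 0` the decay length `L^jη ≥ η` and the bound is King's; the statement holds for all `j : ℕ`):
`Σ_y η^{d+1}χ(y)·exp[−δ₁·tdistT(x, y)∕L^j] ≤ (2(1 + (d+1)∕δ₁))^{d+1}·(L^j∕L^k)^{d+1}` — uniformly in `k`, `M`, `x` (the tree's uniform torus sum
`King1986.Torus.tdistT_sumBound` at rate `δ₁∕L^j` + `B5Bound128Uniform.latticeConst_div_le`). [cite: King1986, (3.68) p.664] -/
theorem sum_eta_pow_mul_exp_le (k j : ℕ) (M : Fin (d + 1) → ℕ) [∀ μ, NeZero (M μ)] (hL : 1 ≤ L) {δ₁ : ℝ} (hδ₁ : 0 < δ₁)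
    {χ : Tor (fine (L ^ k) M) → ℝ} (hχ1 : ∀ y, χ y ≤ 1) (x : Tor (fine (L ^ k) M)) :
    ∑ y, (((L : ℝ) ^ k)⁻¹) ^ (d + 1) * χ y * Real.exp (-(δ₁ * tdistT (fine (L ^ k) M) x y / (L : ℝ) ^ j))
      ≤ (2 * (1 + ((d + 1 : ℕ) : ℝ) / δ₁)) ^ (d + 1) * ((L : ℝ) ^ j / (L : ℝ) ^ k) ^ (d + 1) := by
  have hLr : (1 : ℝ) ≤ L := by exact_mod_cast hL
  have hL0 : (0 : ℝ) < L := by linarith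
  have hLk : (0 : ℝ) < (L : ℝ) ^ k := by positivity
  have hLj : (0 : ℝ) < (L : ℝ) ^ j := by positivity
  have hLj1 : 1 ≤ L ^ j := Nat.one_le_pow _ _ (by omega)
  have hrate : ∀ y, δ₁ * tdistT (fine (L ^ k) M) x y / (L : ℝ) ^ j = δ₁ / ((L ^ j : ℕ) : ℝ) * tdistT (fine (L ^ k) M) x y := by
    intro y; push_cast; field_simp
  have hsum := tdistT_sumBound (K := fine (L ^ k) M) (δ₁ / ((L ^ j : ℕ) : ℝ)) (by positivity) x
  have hC := latticeConst_div_le (d + 1) hδ₁ hLj1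
  set C : ℝ := (2 * (1 + ((d + 1 : ℕ) : ℝ) / δ₁)) ^ (d + 1) with hCdef
  calc ∑ y, (((L : ℝ) ^ k)⁻¹) ^ (d + 1) * χ y * Real.exp (-(δ₁ * tdistT (fine (L ^ k) M) x y / (L : ℝ) ^ j))
      ≤ ∑ y, (((L : ℝ) ^ k)⁻¹) ^ (d + 1) * Real.exp (-(δ₁ / ((L ^ j : ℕ) : ℝ) * tdistT (fine (L ^ k) M) x y)) := by
        refine Finset.sum_le_sum fun y _ => ?_
        rw [hrate y]
        have hE : 0 ≤ Real.exp (-(δ₁ / ((L ^ j : ℕ) : ℝ) * tdistT (fine (L ^ k) M) x y)) := Real.exp_nonneg _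
        calc (((L : ℝ) ^ k)⁻¹) ^ (d + 1) * χ y * Real.exp (-(δ₁ / ((L ^ j : ℕ) : ℝ) * tdistT (fine (L ^ k) M) x y))
            ≤ (((L : ℝ) ^ k)⁻¹) ^ (d + 1) * 1 * Real.exp (-(δ₁ / ((L ^ j : ℕ) : ℝ) * tdistT (fine (L ^ k) M) x y)) :=
              mul_le_mul_of_nonneg_right (mul_le_mul_of_nonneg_left (hχ1 y) (by positivity)) hE
          _ = _ := by rw [mul_one]
    _ = (((L : ℝ) ^ k)⁻¹) ^ (d + 1) * ∑ y, Real.exp (-(δ₁ / ((L ^ j : ℕ) : ℝ) * tdistT (fine (L ^ k) M) x y)) := by rw [Finset.mul_sum]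
    _ ≤ (((L : ℝ) ^ k)⁻¹) ^ (d + 1) * (((L ^ j : ℕ) : ℝ) ^ (d + 1) * C) :=
        mul_le_mul_of_nonneg_left (hsum.trans hC) (by positivity)
    _ = C * ((L : ℝ) ^ j / (L : ℝ) ^ k) ^ (d + 1) := by
        push_cast
        rw [div_pow, inv_pow]
        field_simp

omit [NeZero L] in
/-- the dictionary of (3.68)'s right side: for a coarse slice `j ≤ k`, `(L^j∕L^k) = [L^{k−j}]^{−1}` (`= L^jη`). [cite: King1986, (3.68) p.664] -/
theorem slice_div_eq_inv_pow {j k : ℕ} (hL : 1 ≤ L) (hjk : j ≤ k) : (L : ℝ) ^ j / (L : ℝ) ^ k = ((L : ℝ) ^ (k - j))⁻¹ := by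
  have hLr : (1 : ℝ) ≤ L := by exact_mod_cast hL
  have hL0 : (0 : ℝ) < L := by linarith
  have hsplit : (L : ℝ) ^ k = (L : ℝ) ^ (k - j) * (L : ℝ) ^ j := by rw [← pow_add, Nat.sub_add_cancel hjk]
  rw [hsplit]
  field_simp

end LatticeSum

/-! ## §4 (3.69)–(3.70): the slice sums and the extraction of `L^{−γk}` -/

section SliceSums

/-- `Σ_{m<N} x^m ≤ (1 − x)^{−1}` for `0 ≤ x < 1`. [folklore] -/
theorem geom_sum_le_inv_one_sub {x : ℝ} (hx0 : 0 ≤ x) (hx1 : x < 1) (N : ℕ) :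
    ∑ m ∈ Finset.range N, x ^ m ≤ (1 - x)⁻¹ := by
  have hne : x ≠ 1 := hx1.ne
  rw [geom_sum_eq hne N]
  have h1x : 0 < 1 - x := by linarith
  rw [show (x ^ N - 1) / (x - 1) = (1 - x ^ N) / (1 - x) by
    rw [← neg_sub 1 (x ^ N), ← neg_sub 1 x, neg_div_neg_eq], div_le_iff₀ h1x, inv_mul_cancel₀ h1x.ne']
  linarith [pow_nonneg hx0 N]

/-- THE DICTIONARY: King's slice weight `(L^{j−k})^D` in the fine-run indexing `i = j + n`, `K′ = k + n`, is `x^{K′−i}` with `x = L^{−D}`: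
`(L^{−D})^{K′−i} = L^{D(j−k)}` (`i ≤ K′`, `L > 0`). [cite: King1986, (3.60) p.663, (3.69) p.664] -/
theorem sliceWeight_eq_rpow {L : ℕ} (hL : 0 < L) (D : ℝ) {K' i : ℕ} (hi : i ≤ K') :
    ((L : ℝ) ^ (-D)) ^ (K' - i) = (L : ℝ) ^ (D * ((i : ℝ) - K')) := by
  have hL0 : (0 : ℝ) < L := by exact_mod_cast hL
  rw [← Real.rpow_natCast, ← Real.rpow_mul hL0.le]
  congr 1
  rw [Nat.cast_sub hi]
  ring

/-- ★ **(3.69)**: for `0 ≤ x < 1` (`x = L^{−D(H₁)}`, `D(H₁) > 0`) and `i₂ ≤ K′`: `Σ_{i=0}^{i₂} x^{K′−i} ≤ (1 − x)^{−1}·x^{K′−i₂}` — King's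
`Σ_{j=−n}^{j_{l(2)}} (L^{j−k})^{D(H₁)} ≤ C(L^{j_{l(2)}−k})^{D(H₁)}` with `C = (1 − L^{−D})^{−1}`. [cite: King1986, (3.69) p.664] -/
theorem sliceWeight_sum_le {x : ℝ} (hx0 : 0 ≤ x) (hx1 : x < 1) {K' i₂ : ℕ} (hi₂ : i₂ ≤ K') :
    ∑ i ∈ Finset.range (i₂ + 1), x ^ (K' - i) ≤ (1 - x)⁻¹ * x ^ (K' - i₂) := by
  have hterm : ∀ i ∈ Finset.range (i₂ + 1), x ^ (K' - i) = x ^ (K' - i₂) * x ^ (i₂ - i) := by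
    intro i hi
    rw [Finset.mem_range] at hi
    rw [← pow_add]
    congr 1
    omega
  rw [Finset.sum_congr rfl hterm, ← Finset.mul_sum, mul_comm]
  refine mul_le_mul_of_nonneg_right ?_ (pow_nonneg hx0 _)
  -- re-index `m = i₂ - i`
  have hre : ∑ i ∈ Finset.range (i₂ + 1), x ^ (i₂ - i) = ∑ m ∈ Finset.range (i₂ + 1), x ^ m := by
    rw [← Finset.sum_range_reflect]
    refine Finset.sum_congr rfl fun m hm => ?_
    rw [Finset.mem_range] at hm
    congr 1
    omega
  rw [hre]
  exact geom_sum_le_inv_one_sub hx0 hx1 _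

/-- ★ **(3.70), first inequality**: the FINE slices `i ≤ n` (King's `−n ≤ j ≤ 0`) of the `(k+n)`-run sum to `≤ (1 − x)^{−1}·x^k = C·(L^{−k})^D`.
[cite: King1986, (3.70) p.664] -/
theorem sliceWeight_sum_fine_le {x : ℝ} (hx0 : 0 ≤ x) (hx1 : x < 1) (k n : ℕ) :
    ∑ i ∈ Finset.range (n + 1), x ^ (k + n - i) ≤ (1 - x)⁻¹ * x ^ k := by
  have h := sliceWeight_sum_le hx0 hx1 (K' := k + n) (i₂ := n) (by omega)
  rwa [Nat.add_sub_cancel] at h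

/-- ★ **(3.70), second inequality — THE EXTRACTION OF `L^{−γk}`**: for `L ≥ 1`, `γ ≤ D` and a coarse slice `j ≥ 0` (any `k`):
`(L^{−k})^D ≤ L^{−γk}·(L^{j−k})^{D−γ}` (King: *«This gives … ≤ CL^{−γk}(L^{j_{l(i+1)}−k})^{D(H_i)−γ}»*; `D − γ ≥ 0` is the printed «for γ small enough,
D(H_i) − γ > 0»; the inequality is `0 ≤ (D − γ)·j`). [cite: King1986, (3.70) p.664] -/
theorem rpow_extract_gamma {L : ℕ} (hL : 1 ≤ L) {D γ : ℝ} (hγ : γ ≤ D) (j k : ℕ) :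
    (L : ℝ) ^ (-(D * k)) ≤ (L : ℝ) ^ (-(γ * k)) * (L : ℝ) ^ ((D - γ) * ((j : ℝ) - k)) := by
  have hLr : (1 : ℝ) ≤ L := by exact_mod_cast hL
  have hL0 : (0 : ℝ) < L := by linarith
  rw [← Real.rpow_add hL0]
  apply Real.rpow_le_rpow_of_exponent_le hLr
  have hj0 : (0 : ℝ) ≤ j := Nat.cast_nonneg j
  have hDγ : 0 ≤ D - γ := by linarith
  nlinarith [mul_nonneg hDγ hj0]

/-- (3.70) assembled in King's letters: `x = L^{−D}` lies in `[0, 1)` for `L ≥ 2`, `D > 0`, and `(1 − x)^{−1}·x^k = (1 − L^{−D})^{−1}·L^{−Dk}`.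
[cite: King1986, (3.70) p.664] -/
theorem sliceBase_lt_one {L : ℕ} (hL : 2 ≤ L) {D : ℝ} (hD : 0 < D) :
    0 ≤ (L : ℝ) ^ (-D) ∧ (L : ℝ) ^ (-D) < 1 ∧ ∀ k : ℕ, ((L : ℝ) ^ (-D)) ^ k = (L : ℝ) ^ (-(D * k)) := by
  have hLr : (2 : ℝ) ≤ L := by exact_mod_cast hL
  have hL0 : (0 : ℝ) < L := by linarith
  refine ⟨Real.rpow_nonneg hL0.le _, ?_, fun k => ?_⟩
  · rw [Real.rpow_neg hL0.le]
    apply inv_lt_one_of_one_lt₀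
    exact Real.one_lt_rpow (by linarith) hD
  · rw [← Real.rpow_natCast, ← Real.rpow_mul hL0.le]
    congr 1; ring

end SliceSums

end Summit.QuantumFields.YangMills.BalabanUVNodes.N15KingModelRung.Curved

end
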